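import Summits.Ventures.HSemireg.ObstructionLocusBridge

/-!
# Venture HSemireg — (S5) OBSTRUCTION LOCUS away from secant type, XIII: the BRIDGE, part 2 — the monomial forms are
# `±` basis vectors of Mathlib's `Basis.ExteriorAlgebra`, so the actual contraction rank EQUALS the `κ`-model rank

HONEST FRAMING.  Companion of file XII (cell `pub-hsemireg`, track «S4-PUSH» (ii), seat s4-prove-2): exterior-algebra
algebra over a field, Mathlib's signs and Mathlib's basis of `Λ(W ⊕ W̄)` (`Module.Basis.ExteriorAlgebra`).  Nothing here
says that HC / HC_CM / HC_AV holds; no Literature fact is declared or used; `[B_S] ∼ c_S · b_S` (`c_S ≠ 0`) and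
`⊕H^{p,q} = Λ(W ⊕ W̄)` stay DICTIONARY — they are the only non-Lean words between the headline below and «rank of Bloch's
`ξ ↦ ξ ⌟ [Z]` on `H¹(T_X)` for the class of a near pair of coordinate sub-tori».

* `genBasis` — the coordinate basis of `W ⊕ W̄` indexed by `Lex (Fin n ⊕ Fin n)` (`inl k ↦ dz_k`, `inr k ↦ dz̄_k`);
  `formBasis = genBasis.ExteriorAlgebra`; `formBasis_singleton`, `dz_eq_formBasis`, `dzb_eq_formBasis`, `formBasis_empty`.
* **`formBasis_mul_of_disjoint`** — `e_s * e_t = c • e_{s ∪ t}` with `c = ±1 ≠ 0` for disjoint `s, t`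
  (`ExteriorAlgebra.basis_mul_of_disjoint`).
* `genSet (A, B)` (the generator set: `dz`-indices `A`, `dz̄`-indices `B`), `genSet_injective`;
  **`bS_eq_smul_formBasis`** (`b_A = c • e_{genSet (A, A)}`), `dzb_dzb_bS_eq_smul_formBasis`,
  **`monoForm_tg_eq_smul_formBasis`** (the monomial form of an active source is `c • e_{genSet (tg S q)}`, `c ≠ 0`).
* `linearIndependent_formBasis_genSet`, `monoFormMap_apply`, `exists_coef`, **`eq_zero_of_monoFormMap_eq_zero`**
  (`monoFormMap` is injective on coefficient vectors supported on target monomials of active sources),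
  `range_kappa_pair_support` (the `κ`-model's range is so supported).
* **`finrank_range_blochKappa_pair`** — for every near pair, the rank of the ACTUAL map `ξ ↦ ξ ⌟ (b_S + b_{S'})` on
  `H¹(T)`-coefficients into `Λ(W ⊕ W̄)` EQUALS file VII's `2p(N−p) − (p−1)(N−p−1) − 1`;
  **`finrank_range_blochKappa_pair_weil`** — `= n² + 2n − 2` at the Weil rung (`N = 2n`, `|S| = n`);
  `finrank_range_blochKappa_single` — one sub-torus: `(N − |S|)·|S|` (`= n²`, «single torus INJ n²» on actual forms).
(Elaboration note: `Fintype.linearIndependent_iff` over the index type `Finset × Finset` times out at `whnf`;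
`linearIndependent_iff'` with `Finset.univ` is used instead.)
-/

open scoped BigOperators
open CliffordAlgebra Finset

namespace Summit.Ventures.HSemireg.ObstructionLocus

variable (K : Type*) [Field K] (n : ℕ)

/-- The coordinate basis of the `1`-forms `W ⊕ W̄`, indexed by `Lex (Fin n ⊕ Fin n)` (`inl k ↦ dz_k`, `inr k ↦ dz̄_k`). -/
noncomputable def genBasis : Module.Basis (Lex (Fin n ⊕ Fin n)) K (OneForms K n) :=
  ((Pi.basisFun K (Fin n)).prod (Pi.basisFun K (Fin n))).reindex toLex

/-- Mathlib's basis of the exterior algebra `Λ(W ⊕ W̄)`, indexed by finite sets of generators. -/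
noncomputable def formBasis : Module.Basis (Finset (Lex (Fin n ⊕ Fin n))) K (Forms K n) :=
  (genBasis K n).ExteriorAlgebra

variable {K n}

/-- `genBasis (inl k) = dz_k`'s vector. -/
theorem genBasis_inl (k : Fin n) : genBasis K n (toLex (Sum.inl k)) = ((Pi.single k 1, 0) : OneForms K n) := by
  rw [genBasis, Module.Basis.reindex_apply]
  change ((Pi.basisFun K (Fin n)).prod (Pi.basisFun K (Fin n))) (Sum.inl k) = _
  rw [Module.Basis.prod_apply]
  simp [Pi.basisFun_apply]

/-- `genBasis (inr k) = dz̄_k`'s vector. -/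
theorem genBasis_inr (k : Fin n) : genBasis K n (toLex (Sum.inr k)) = ((0, Pi.single k 1) : OneForms K n) := by
  rw [genBasis, Module.Basis.reindex_apply]
  change ((Pi.basisFun K (Fin n)).prod (Pi.basisFun K (Fin n))) (Sum.inr k) = _
  rw [Module.Basis.prod_apply]
  simp [Pi.basisFun_apply]

/-- A singleton basis vector of the exterior algebra is the generator. -/
theorem formBasis_singleton (x : Lex (Fin n ⊕ Fin n)) :
    formBasis K n {x} = ExteriorAlgebra.ι K (genBasis K n x) := by
  rw [formBasis, ExteriorAlgebra.basis_apply_ofCard (genBasis K n) (Finset.card_singleton x),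
    ExteriorAlgebra.ιMulti_family, ExteriorAlgebra.ιMulti_apply]
  simp [Set.powersetCard.ofFinEmbEquiv_symm_apply, Set.powersetCard.val_ofCard, Finset.orderEmbOfFin_singleton]

/-- `dz_k` is the basis vector of the singleton `{inl k}`. -/
theorem dz_eq_formBasis (k : Fin n) : (dz k : Forms K n) = formBasis K n {toLex (Sum.inl k)} := by
  rw [formBasis_singleton, genBasis_inl, dz]

/-- `dz̄_k` is the basis vector of the singleton `{inr k}`. -/
theorem dzb_eq_formBasis (k : Fin n) : (dzb k : Forms K n) = formBasis K n {toLex (Sum.inr k)} := by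
  rw [formBasis_singleton, genBasis_inr, dzb]

/-- The empty basis vector is `1`. -/
theorem formBasis_empty : formBasis K n ∅ = (1 : Forms K n) := by
  rw [formBasis, ExteriorAlgebra.basis_apply_ofCard (genBasis K n) Finset.card_empty,
    ExteriorAlgebra.ιMulti_family, ExteriorAlgebra.ιMulti_zero_apply]

/-- **Products of disjoint basis vectors are basis vectors up to a non-zero scalar (a sign).** -/
theorem formBasis_mul_of_disjoint {s t : Finset (Lex (Fin n ⊕ Fin n))} (h : Disjoint s t) :
    ∃ c : K, c ≠ 0 ∧ formBasis K n s * formBasis K n t = c • formBasis K n (s ∪ t) := by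
  have hmul := ExteriorAlgebra.basis_mul_of_disjoint (genBasis K n)
    (Set.powersetCard.ofCard (rfl : s.card = s.card)) (Set.powersetCard.ofCard (rfl : t.card = t.card)) h
  rw [Set.powersetCard.coe_disjUnion, Finset.disjUnion_eq_union] at hmul
  obtain ⟨u, hu⟩ : ∃ u : ℤˣ, formBasis K n s * formBasis K n t = u • formBasis K n (s ∪ t) := ⟨_, hmul⟩
  refine ⟨((u : ℤ) : K), ?_, ?_⟩
  · rcases Int.units_eq_one_or u with h1 | h1
    · rw [h1]; simp
    · rw [h1]; simp
  · rw [Int.cast_smul_eq_zsmul, ← Units.smul_def]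
    exact hu

/-- The generator set of the monomial index `(A, B)`: `dz`-generators `A`, `dz̄`-generators `B`. -/
def genSet (m : Mono n) : Finset (Lex (Fin n ⊕ Fin n)) :=
  m.1.map ⟨fun a => toLex (Sum.inl a), fun a b h => by simpa using h⟩
    ∪ m.2.map ⟨fun b => toLex (Sum.inr b), fun a b h => by simpa using h⟩

/-- Membership in `genSet`. -/
theorem mem_genSet {m : Mono n} {x : Lex (Fin n ⊕ Fin n)} :
    x ∈ genSet m ↔ (∃ a ∈ m.1, toLex (Sum.inl a) = x) ∨ (∃ b ∈ m.2, toLex (Sum.inr b) = x) := by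
  simp [genSet, Finset.mem_union, Finset.mem_map]

/-- A `dz`-index `inl a` lies in `genSet (A, B)` iff `a ∈ A`. -/
theorem inl_mem_genSet {m : Mono n} {a : Fin n} : toLex (Sum.inl a) ∈ genSet m ↔ a ∈ m.1 := by
  rw [mem_genSet]
  constructor
  · rintro (⟨a', ha', h⟩ | ⟨b, _, h⟩)
    · have : a' = a := by simpa using h
      exact this ▸ ha'
    · exact absurd h (by simp)
  · exact fun h => Or.inl ⟨a, h, rfl⟩

/-- A `dz̄`-index `inr b` lies in `genSet (A, B)` iff `b ∈ B`. -/
theorem inr_mem_genSet {m : Mono n} {b : Fin n} : toLex (Sum.inr b) ∈ genSet m ↔ b ∈ m.2 := by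
  rw [mem_genSet]
  constructor
  · rintro (⟨a, _, h⟩ | ⟨b', hb', h⟩)
    · exact absurd h (by simp)
    · have : b' = b := by simpa using h
      exact this ▸ hb'
  · exact fun h => Or.inr ⟨b, h, rfl⟩

/-- `genSet` is injective: the generator set remembers `(A, B)`. -/
theorem genSet_injective : Function.Injective (genSet (n := n)) := by
  rintro ⟨A, B⟩ ⟨A', B'⟩ h
  have h1 : A = A' := by
    ext a
    have := (inl_mem_genSet (m := (A, B)) (a := a)).symm.trans (h ▸ (inl_mem_genSet (m := (A', B')) (a := a)))
    exact this
  have h2 : B = B' := by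
    ext b
    have := (inr_mem_genSet (m := (A, B)) (b := b)).symm.trans (h ▸ (inr_mem_genSet (m := (A', B')) (b := b)))
    exact this
  rw [h1, h2]

/-- `b_A` is a non-zero multiple of the basis vector of `genSet (A, A)`. -/
theorem bS_eq_smul_formBasis (A : Finset (Fin n)) :
    ∃ c : K, c ≠ 0 ∧ (bS A : Forms K n) = c • formBasis K n (genSet (A, A)) := by
  induction A using Finset.induction_on with
  | empty =>
    refine ⟨1, one_ne_zero, ?_⟩
    rw [bS_empty, one_smul]
    have : genSet (n := n) (∅, ∅) = ∅ := by simp [genSet]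
    rw [this, formBasis_empty]
  | insert a A ha ih =>
    obtain ⟨c, hc, hA⟩ := ih
    -- `dz_a * dz̄_a = c₁ • e_{ {inl a, inr a} }`
    have hd : Disjoint ({toLex (Sum.inl a)} : Finset (Lex (Fin n ⊕ Fin n))) {toLex (Sum.inr a)} := by
      simp
    obtain ⟨c₁, hc₁, h₁⟩ := formBasis_mul_of_disjoint (K := K) hd
    -- and `{inl a, inr a}` is disjoint from `genSet (A, A)`
    have hd2 : Disjoint (({toLex (Sum.inl a)} : Finset _) ∪ {toLex (Sum.inr a)}) (genSet (n := n) (A, A)) := by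
      rw [Finset.disjoint_left]
      intro x hx hx'
      rcases Finset.mem_union.1 hx with hx | hx
      · rw [Finset.mem_singleton] at hx; subst hx
        exact ha (inl_mem_genSet.1 hx')
      · rw [Finset.mem_singleton] at hx; subst hx
        exact ha (inr_mem_genSet.1 hx')
    obtain ⟨c₂, hc₂, h₂⟩ := formBasis_mul_of_disjoint (K := K) hd2
    refine ⟨c₁ * c * c₂, mul_ne_zero (mul_ne_zero hc₁ hc) hc₂, ?_⟩
    have hset : ({toLex (Sum.inl a)} : Finset _) ∪ {toLex (Sum.inr a)} ∪ genSet (n := n) (A, A)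
        = genSet (insert a A, insert a A) := by
      ext x
      simp only [Finset.mem_union, Finset.mem_singleton, mem_genSet, Finset.mem_insert]
      constructor
      · rintro ((rfl | rfl) | (⟨a', ha', rfl⟩ | ⟨b, hb, rfl⟩))
        · exact Or.inl ⟨a, Or.inl rfl, rfl⟩
        · exact Or.inr ⟨a, Or.inl rfl, rfl⟩
        · exact Or.inl ⟨a', Or.inr ha', rfl⟩
        · exact Or.inr ⟨b, Or.inr hb, rfl⟩
      · rintro (⟨a', rfl | ha', rfl⟩ | ⟨b, rfl | hb, rfl⟩)
        · exact Or.inl (Or.inl rfl)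
        · exact Or.inr (Or.inl ⟨a', ha', rfl⟩)
        · exact Or.inl (Or.inr rfl)
        · exact Or.inr (Or.inr ⟨b, hb, rfl⟩)
    rw [bS_insert ha, pairForm, hA, dz_eq_formBasis, dzb_eq_formBasis, h₁, smul_mul_smul_comm, h₂, smul_smul,
      hset]

/-- `dz̄_a * dz̄_b * b_A` (`a ≠ b`, both outside `A`) is a non-zero multiple of the basis vector of
`genSet (A, A + a + b)`. -/
theorem dzb_dzb_bS_eq_smul_formBasis {A : Finset (Fin n)} {a b : Fin n} (hab : a ≠ b) (ha : a ∉ A) (hb : b ∉ A) :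
    ∃ c : K, c ≠ 0 ∧ (dzb a * dzb b * bS A : Forms K n) = c • formBasis K n (genSet (A, insert a (insert b A))) := by
  obtain ⟨c, hc, hA⟩ := bS_eq_smul_formBasis (K := K) A
  have hd : Disjoint ({toLex (Sum.inr a)} : Finset (Lex (Fin n ⊕ Fin n))) {toLex (Sum.inr b)} := by
    simpa using hab
  obtain ⟨c₁, hc₁, h₁⟩ := formBasis_mul_of_disjoint (K := K) hd
  have hd2 : Disjoint (({toLex (Sum.inr a)} : Finset _) ∪ {toLex (Sum.inr b)}) (genSet (n := n) (A, A)) := by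
    rw [Finset.disjoint_left]
    intro x hx hx'
    rcases Finset.mem_union.1 hx with hx | hx
    · rw [Finset.mem_singleton] at hx; subst hx; exact ha (inr_mem_genSet.1 hx')
    · rw [Finset.mem_singleton] at hx; subst hx; exact hb (inr_mem_genSet.1 hx')
  obtain ⟨c₂, hc₂, h₂⟩ := formBasis_mul_of_disjoint (K := K) hd2
  refine ⟨c₁ * c * c₂, mul_ne_zero (mul_ne_zero hc₁ hc) hc₂, ?_⟩
  have hset : ({toLex (Sum.inr a)} : Finset _) ∪ {toLex (Sum.inr b)} ∪ genSet (n := n) (A, A)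
      = genSet (A, insert a (insert b A)) := by
    ext x
    simp only [Finset.mem_union, Finset.mem_singleton, mem_genSet, Finset.mem_insert]
    constructor
    · rintro ((rfl | rfl) | (⟨a', ha', rfl⟩ | ⟨b', hb', rfl⟩))
      · exact Or.inr ⟨a, Or.inl rfl, rfl⟩
      · exact Or.inr ⟨b, Or.inr (Or.inl rfl), rfl⟩
      · exact Or.inl ⟨a', ha', rfl⟩
      · exact Or.inr ⟨b', Or.inr (Or.inr hb'), rfl⟩
    · rintro (⟨a', ha', rfl⟩ | ⟨b', rfl | rfl | hb', rfl⟩)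
      · exact Or.inr (Or.inl ⟨a', ha', rfl⟩)
      · exact Or.inl (Or.inl rfl)
      · exact Or.inl (Or.inr rfl)
      · exact Or.inr (Or.inr ⟨b', hb', rfl⟩)
  rw [hA, dzb_eq_formBasis, dzb_eq_formBasis, h₁, smul_mul_smul_comm, h₂, smul_smul, hset]

/-- **The monomial form of an active source is a non-zero multiple of the basis vector of its generator set.** -/
theorem monoForm_tg_eq_smul_formBasis {S : Finset (Fin n)} {i k : Fin n} (hi : i ∉ S) (hk : k ∈ S) :
    ∃ c : K, c ≠ 0 ∧ (monoForm (tg S (i, k)) : Forms K n) = c • formBasis K n (genSet (tg S (i, k))) := by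
  have hik : i ≠ k := by rintro rfl; exact hi hk
  have hiA : i ∉ S.erase k := fun h => hi (Finset.mem_of_mem_erase h)
  have hkA : k ∉ S.erase k := Finset.notMem_erase k S
  have hS : insert i S = insert i (insert k (S.erase k)) := by rw [Finset.insert_erase hk]
  rw [monoForm_tg hi hk]
  rcases lt_or_gt_of_ne hik with h | h
  · obtain ⟨c, hc, e⟩ := dzb_dzb_bS_eq_smul_formBasis (K := K) hik hiA hkA
    refine ⟨c, hc, ?_⟩
    rw [if_pos h, e, tg]
    dsimp only
    rw [hS]
  · obtain ⟨c, hc, e⟩ := dzb_dzb_bS_eq_smul_formBasis (K := K) hik.symm hkA hiA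
    refine ⟨c, hc, ?_⟩
    rw [if_neg (not_lt.2 h.le), e, tg]
    dsimp only
    rw [hS, Finset.insert_comm]

/-- The basis vectors indexed through `genSet` are linearly independent. -/
theorem linearIndependent_formBasis_genSet :
    LinearIndependent K (fun m : Mono n => formBasis K n (genSet m)) :=
  (formBasis K n).linearIndependent.comp genSet genSet_injective

/-- `monoFormMap` as an explicit sum. -/
theorem monoFormMap_apply (x : Mono n → K) : monoFormMap x = ∑ m, x m • (monoForm m : Forms K n) := by
  simp only [monoFormMap, LinearMap.sum_apply, LinearMap.smulRight_apply, LinearMap.proj_apply]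

/-- A total coefficient function: on the target monomials of active sources, `monoForm m = coef m • e_{genSet m}` with
`coef m ≠ 0`. -/
theorem exists_coef (S S' : Finset (Fin n)) :
    ∃ c : Mono n → K, ∀ m ∈ (act S).image (tg S) ∪ (act S').image (tg S'),
      c m ≠ 0 ∧ (monoForm m : Forms K n) = c m • formBasis K n (genSet m) := by
  have hcoef : ∀ m : Mono n, ∃ c : K, m ∈ (act S).image (tg S) ∪ (act S').image (tg S') →
      c ≠ 0 ∧ (monoForm m : Forms K n) = c • formBasis K n (genSet m) := by
    intro m
    by_cases hm : m ∈ (act S).image (tg S) ∪ (act S').image (tg S')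
    · rcases Finset.mem_union.1 hm with hm' | hm'
      · obtain ⟨q, hq, rfl⟩ := Finset.mem_image.1 hm'
        obtain ⟨hi, hk⟩ := mem_act.1 hq
        obtain ⟨c, hc, e⟩ := monoForm_tg_eq_smul_formBasis (K := K) hi hk
        exact ⟨c, fun _ => ⟨hc, e⟩⟩
      · obtain ⟨q, hq, rfl⟩ := Finset.mem_image.1 hm'
        obtain ⟨hi, hk⟩ := mem_act.1 hq
        obtain ⟨c, hc, e⟩ := monoForm_tg_eq_smul_formBasis (K := K) hi hk
        exact ⟨c, fun _ => ⟨hc, e⟩⟩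
    · exact ⟨1, fun h => absurd h hm⟩
  choose c hc using hcoef
  exact ⟨c, hc⟩

/-- **`monoFormMap` is injective on vectors supported on target monomials of active sources.** -/
theorem eq_zero_of_monoFormMap_eq_zero (S S' : Finset (Fin n)) (x : Mono n → K)
    (hx : ∀ m, x m ≠ 0 → m ∈ (act S).image (tg S) ∪ (act S').image (tg S'))
    (h0 : monoFormMap x = (0 : Forms K n)) : x = 0 := by
  obtain ⟨c, hc⟩ := exists_coef (K := K) S S'
  have hx0 : ∀ m, m ∉ (act S).image (tg S) ∪ (act S').image (tg S') → x m = 0 :=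
    fun m hm => by_contra (fun hne => hm (hx m hne))
  have hsum : ∑ m, (x m * c m) • formBasis K n (genSet m) = 0 := by
    rw [← h0, monoFormMap_apply]
    refine Finset.sum_congr rfl fun m _ => ?_
    by_cases hm : m ∈ (act S).image (tg S) ∪ (act S').image (tg S')
    · rw [(hc m hm).2, smul_smul]
    · rw [hx0 m hm, zero_mul, zero_smul, zero_smul]
  have hg' := linearIndependent_iff'.1 (linearIndependent_formBasis_genSet (K := K) (n := n)) Finset.univ
    (fun m => x m * c m) hsum
  have hg : ∀ m, x m * c m = 0 := fun m => hg' m (Finset.mem_univ m)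
  funext m
  rw [Pi.zero_apply]
  by_cases hm : m ∈ (act S).image (tg S) ∪ (act S').image (tg S')
  · exact (mul_eq_zero.1 (hg m)).resolve_right (hc m hm).1
  · exact hx0 m hm

/-- The range of the `κ`-model is supported on target monomials of active sources. -/
theorem range_kappa_pair_support (S S' : Finset (Fin n)) (ε ε' : Fin n × Fin n → K)
    {y : Mono n → K} (hy : y ∈ LinearMap.range (kappa S ε + kappa S' ε')) :
    ∀ m, y m ≠ 0 → m ∈ (act S).image (tg S) ∪ (act S').image (tg S') := by
  obtain ⟨v, rfl⟩ := hy
  intro m hm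
  rw [LinearMap.add_apply, Pi.add_apply, kappa_apply, kappa_apply] at hm
  by_contra hnot
  rw [Finset.mem_union, not_or, Finset.mem_image, Finset.mem_image, not_exists, not_exists] at hnot
  apply hm
  rw [Finset.sum_eq_zero, Finset.sum_eq_zero, add_zero]
  · intro q hq
    exact absurd ⟨(Finset.mem_filter.1 hq).1, (Finset.mem_filter.1 hq).2⟩ (not_and.2 (fun h1 h2 => hnot.2 q ⟨h1, h2⟩))
  · intro q hq
    exact absurd ⟨(Finset.mem_filter.1 hq).1, (Finset.mem_filter.1 hq).2⟩ (not_and.2 (fun h1 h2 => hnot.1 q ⟨h1, h2⟩))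

/-- **THE BRIDGE, with equality.**  For a near pair, the rank of the ACTUAL contraction map
`ξ ↦ ξ ⌟ (b_S + b_{S'})` on `H¹(T_X)`-coefficients into `Λ(W ⊕ W̄)` (Mathlib's exterior algebra, Mathlib's signs)
EQUALS file VII's closed form `2p(N−p) − (p−1)(N−p−1) − 1`. -/
theorem finrank_range_blochKappa_pair {S S' : Finset (Fin n)} (hSS' : S ≠ S') {k k' : Fin n} (hk : k ∈ S)
    (hk' : k' ∈ S') (he : S.erase k = S'.erase k') :
    Module.finrank K (LinearMap.range (blochKappa (bS S + bS S' : Forms K n)))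
      = 2 * ((n - S.card) * S.card) - (n - S.card - 1) * (S.card - 1) - 1 := by
  rw [blochKappa_bS_add, LinearMap.range_comp,
    ← finrank_range_kappa_pair_of_near hSS' hk hk' he (fun q _ => sgn_ne_zero (K := K) q)
      (fun q _ => sgn_ne_zero (K := K) q), ← LinearMap.range_domRestrict]
  apply LinearMap.finrank_range_of_inj
  intro y₁ y₂ h
  apply Subtype.ext
  have hsub : monoFormMap (y₁.1 - y₂.1) = (0 : Forms K n) := by
    rw [map_sub, sub_eq_zero]; exact h
  have hmem : y₁.1 - y₂.1 ∈ LinearMap.range (kappa S (sgn (K := K)) + kappa S' (sgn (K := K))) :=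
    Submodule.sub_mem _ y₁.2 y₂.2
  have := eq_zero_of_monoFormMap_eq_zero S S' _ (range_kappa_pair_support S S' _ _ hmem) hsub
  exact sub_eq_zero.1 this

/-- **At the Weil rung** (`N = 2n`, `|S| = n`): the actual rank is `n² + 2n − 2`. -/
theorem finrank_range_blochKappa_pair_weil {m : ℕ} {S S' : Finset (Fin (2 * m))} (hSS' : S ≠ S') {k k' : Fin (2 * m)}
    (hk : k ∈ S) (hk' : k' ∈ S') (he : S.erase k = S'.erase k') (hS : S.card = m) :
    Module.finrank K (LinearMap.range (blochKappa (bS S + bS S' : Forms K (2 * m)))) = m ^ 2 + 2 * m - 2 := by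
  rw [blochKappa_bS_add, LinearMap.range_comp,
    ← finrank_range_kappa_pair_weil hSS' hk hk' he hS (fun q _ => sgn_ne_zero (K := K) q)
      (fun q _ => sgn_ne_zero (K := K) q), ← LinearMap.range_domRestrict]
  apply LinearMap.finrank_range_of_inj
  intro y₁ y₂ h
  apply Subtype.ext
  have hsub : monoFormMap (y₁.1 - y₂.1) = (0 : Forms K (2 * m)) := by
    rw [map_sub, sub_eq_zero]; exact h
  have hmem : y₁.1 - y₂.1 ∈ LinearMap.range (kappa S (sgn (K := K)) + kappa S' (sgn (K := K))) :=
    Submodule.sub_mem _ y₁.2 y₂.2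
  have := eq_zero_of_monoFormMap_eq_zero S S' _ (range_kappa_pair_support S S' _ _ hmem) hsub
  exact sub_eq_zero.1 this

/-- **Single sub-torus, actual forms**: the rank of `ξ ↦ ξ ⌟ b_S` on `H¹(T)`-coefficients into `Λ(W ⊕ W̄)` is
`(N − |S|)·|S|` (`= n²` at the Weil rung) — file VI's `finrank_range_kappa` transported («single torus INJ n²»). -/
theorem finrank_range_blochKappa_single (S : Finset (Fin n)) :
    Module.finrank K (LinearMap.range (blochKappa (bS S : Forms K n))) = (n - S.card) * S.card := by
  rw [blochKappa_bS, LinearMap.range_comp, ← finrank_range_kappa S (fun q _ => sgn_ne_zero (K := K) q),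
    ← LinearMap.range_domRestrict]
  apply LinearMap.finrank_range_of_inj
  intro y₁ y₂ h
  apply Subtype.ext
  have hsub : monoFormMap (y₁.1 - y₂.1) = (0 : Forms K n) := by
    rw [map_sub, sub_eq_zero]; exact h
  -- support of the range of `kappa S sgn`: target monomials of active sources (pair lemma with `S' = S`)
  have hmem : y₁.1 - y₂.1 ∈ LinearMap.range (kappa S (sgn (K := K))) := Submodule.sub_mem _ y₁.2 y₂.2
  have hsupp : ∀ m, (y₁.1 - y₂.1) m ≠ 0 → m ∈ (act S).image (tg S) ∪ (act S).image (tg S) := by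
    obtain ⟨v, hv⟩ := hmem
    intro m hm
    rw [Finset.union_idempotent]
    rw [← hv, kappa_apply] at hm
    by_contra hnot
    rw [Finset.mem_image, not_exists] at hnot
    apply hm
    refine Finset.sum_eq_zero fun q hq => ?_
    exact absurd ⟨(Finset.mem_filter.1 hq).1, (Finset.mem_filter.1 hq).2⟩ (not_and.2 fun h1 h2 => hnot q ⟨h1, h2⟩)
  have := eq_zero_of_monoFormMap_eq_zero S S _ hsupp hsub
  exact sub_eq_zero.1 this

end Summit.Ventures.HSemireg.ObstructionLocus
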